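import Literature.NumberTheory.EllipticCurves.MordellWeilTheoremProofs
import Literature.NumberTheory.EllipticCurves.QuadraticTwistRank
import Mathlib.RingTheory.AdjoinRoot
import Mathlib.Algebra.Polynomial.Module.AEval
import Mathlib.Algebra.Module.Torsion.Basic
import Mathlib.RingTheory.Polynomial.Cyclotomic.Roots
import Mathlib.RingTheory.IsTensorProduct
import Mathlib.LinearAlgebra.Dimension.Localization
import Mathlib.LinearAlgebra.TensorProduct.Tower
import Mathlib.FieldTheory.Galois.Basic
import HarnessLib

/-!
# The Mordell–Weil rank in a cyclic extension of prime degree: `rank E(F) = rank E(K) + (ℓ - 1)·d`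

For a Galois extension of number fields `F/K` of prime degree `ℓ` (so `Gal(F/K) ≅ C_ℓ`) and an
elliptic curve `E/K`,

`rank_ℤ E(F) = rank_ℤ E(K) + (ℓ - 1) · d` for some `d ≥ 0`

(`WeierstrassCurve.exists_mordellWeilRank_baseChange_eq_add_mul_of_prime`): the representation
`E(F) ⊗ ℚ` of `C_ℓ` decomposes as `(E(K) ⊗ ℚ) ⊕ V` where `V`, the kernel of the norm, is a vector
space over `ℚ[C_ℓ]/(norm) = ℚ[X]/(Φ_ℓ) = ℚ(ζ_ℓ)`, of dimension `ℓ - 1` over `ℚ`; equivalently the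
`ℓ - 1` faithful characters of `C_ℓ` are conjugate over `ℚ` and occur in `E(F) ⊗ ℂ` with a common
multiplicity `d`. This is the standard Artin-formalism constraint behind rank computations "over
all minimal non-trivial subfields" of an abelian extension, e.g. in the proof of Theorem 2 of
T. Dokchitser–V. Dokchitser, *A note on the Mordell–Weil rank modulo `n`*, J. Number Theory 131
(2011) 1833–1839 (arXiv:0910.4588), where `rk E/F₅ = 1` for the `C₅ × C₅`-extension `F₅/ℚ` is
obtained from `2`-descents over its six quintic subfields `K`: for each of them
`rk E(K) = rk E(ℚ) + 4 d_K`, so that `rk E(K) ≤ 4` together with `rk E(ℚ) = 1` already forces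
`rk E(K) = 1` (tree files `Literature/Barriers/BirchSwinnertonDyer/RankNotSumOfLocalInvariants*.lean`).
Everything in this file is proved; the case `ℓ = 2` is the rank part of the classical
`rank E(K) = rank E(F) + rank E^{(c)}(F)` (`QuadraticTwistRank.lean`, without the identification of
the new part with a twist).

## Contents (all proved)

* `Literature.NumberTheory.EllipticCurves.exists_finrank_eq_mul_of_sum_pow_eq_zero`: if an
  endomorphism `T` of a finitely generated abelian group `B` satisfies `1 + T + ⋯ + T^{ℓ-1} = 0`
  (`ℓ` prime), then `(ℓ - 1) ∣ rank_ℤ B` — `ℚ ⊗ B` is a vector space over the field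
  `ℚ[X]/(Φ_ℓ)` (Mathlib: `Polynomial.cyclotomic.irreducible_rat`, `AdjoinRoot.instField`,
  `Module.AEval'`, `Module.IsTorsionBySet.module`, `Module.finrank_mul_finrank`,
  `IsBaseChange.finrank_eq`).
* `Literature.NumberTheory.EllipticCurves.exists_finrank_eq_finrank_add_mul_of_prime_card`: for a
  group `G` of prime order `ℓ` acting on a finitely generated abelian group `M` with invariants
  `A`, `rank_ℤ M = rank_ℤ A + (ℓ - 1) d` — with the norm `N = ∑_g g` and `B = ker N`: `A ∩ B` is
  `ℓ`-torsion, `ℓ M ⊆ A + B` (`N² = ℓ N`), so `rank M = rank A + rank B`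
  (`rank_eq_add_of_isCompl_up_to_torsion`, `QuadraticTwistRank.lean`), and a generator `σ` of `G`
  acts on `B` with `1 + σ + ⋯ + σ^{ℓ-1} = N|_B = 0`.
* `WeierstrassCurve.exists_mordellWeilRank_baseChange_eq_add_mul_of_prime`: the statement above,
  for `WeierstrassCurve.mordellWeilRank` (`= Module.finrank ℤ E(·)`, honest by the Mordell–Weil
  theorem proved in the tree, `WeierstrassCurve.module_finite_point_holds`); `Gal(F/K)` acts on
  `E(F)` through Mathlib's `WeierstrassCurve.Affine.Point.map`, and the invariants are `E(K)` by
  Galois descent (`IsGalois.mem_range_algebraMap_iff_fixed`).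

## Design notes

Theorems only (no definitions, no named facts). `noncomputable section`, `open scoped Classical`
and no `[DecidableEq]` variables, as in `MordellWeil.lean`, so that the group law on points is
elaborated against the classical instance carried by `WeierstrassCurve.mordellWeilRank`. The base
and extension fields are `K F : Type` (universe `0`), matching the barrier files that consume the
theorem. The curve theorem is placed in `namespace WeierstrassCurve` as a deliberate dot-notation
extension (like `WeierstrassCurve.mordellWeilRank_baseChange_of_finrank_eq_two`).

## References

* T. Dokchitser, V. Dokchitser, *A note on the Mordell–Weil rank modulo `n`*, J. Number Theory
  131 (2011) 1833–1839, arXiv:0910.4588: proof of Thm. 2 ("2-descent shows that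
  `rk E/F₃ = rk E/F₅ = 1` […] over all minimal non-trivial subfields of `F_n`").
  [DokchitserDokchitser2011RankModN]
* J. H. Silverman, *The Arithmetic of Elliptic Curves*, 2nd ed., GTM 106 (2009), Thm. VIII.6.7
  (Mordell–Weil). [SilvermanAEC2009]
-/

noncomputable section

open scoped Classical TensorProduct

open Module Polynomial

namespace Literature.NumberTheory.EllipticCurves

/-! ### Algebra I: an endomorphism killed by the `ℓ`-th cyclotomic polynomial -/

/-- If an endomorphism `T` of a finitely generated abelian group `B` satisfies
`1 + T + ⋯ + T^{ℓ-1} = 0` for a prime `ℓ`, then `rank_ℤ B` is a multiple of `ℓ - 1`: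
`ℚ ⊗ B` is a vector space over the field `ℚ[X]/(Φ_ℓ) = ℚ(ζ_ℓ)` of degree `ℓ - 1`.
[folklore] -/
theorem exists_finrank_eq_mul_of_sum_pow_eq_zero {B : Type*} [AddCommGroup B] [Module.Finite ℤ B]
    (T : Module.End ℤ B) {ℓ : ℕ} (hℓ : ℓ.Prime) (hT : ∑ j ∈ Finset.range ℓ, T ^ j = 0) :
    ∃ d : ℕ, Module.finrank ℤ B = (ℓ - 1) * d := by
  haveI : Fact ℓ.Prime := ⟨hℓ⟩
  -- the base change `V = ℚ ⊗ B` and `T_V = 1 ⊗ T`, killed by `Φ_ℓ`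
  set V := ℚ ⊗[ℤ] B with hV
  set TV : Module.End ℚ V := Module.End.baseChangeHom ℤ ℚ B T with hTV
  have hTV0 : aeval TV (cyclotomic ℓ ℚ) = 0 := by
    rw [cyclotomic_prime, map_sum]
    simp only [aeval_X_pow]
    rw [hTV]
    simp_rw [← map_pow]
    rw [← map_sum, hT, map_zero]
  -- `V` as a `ℚ[X]`-module through `T_V` is killed by `(Φ_ℓ)`, hence is a module over the
  -- field `L = ℚ[X]/(Φ_ℓ)` of degree `ℓ - 1`
  set W := Module.AEval' TV with hW
  have htors : Module.IsTorsionBySet ℚ[X] W ↑(Ideal.span {cyclotomic ℓ ℚ}) := by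
    refine (Module.isTorsionBySet_span_singleton_iff (R := ℚ[X]) (M := W) _).mpr ?_
    intro w
    change Module.AEval.of ℚ V TV (aeval TV (cyclotomic ℓ ℚ) • (Module.AEval.of ℚ V TV).symm w) = 0
    rw [hTV0, zero_smul, map_zero]
  haveI hirr : Fact (Irreducible (cyclotomic ℓ ℚ)) := ⟨cyclotomic.irreducible_rat hℓ.pos⟩
  set L := AdjoinRoot (cyclotomic ℓ ℚ) with hL
  letI : Module L W := Module.IsTorsionBySet.module htors
  haveI : IsScalarTower ℚ L W := htors.isScalarTower
  have hLdeg : Module.finrank ℚ L = ℓ - 1 := by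
    rw [PowerBasis.finrank (AdjoinRoot.powerBasis (cyclotomic_ne_zero ℓ ℚ)),
      AdjoinRoot.powerBasis_dim, natDegree_cyclotomic, Nat.totient_prime hℓ]
  have hmul := Module.finrank_mul_finrank ℚ L W
  have hWV : Module.finrank ℚ W = Module.finrank ℚ V :=
    (Module.AEval.of ℚ V TV).finrank_eq.symm
  have hbc : Module.finrank ℚ V = Module.finrank ℤ B :=
    (TensorProduct.isBaseChange (R := ℤ) (S := ℚ) (M := B)).finrank_eq
  exact ⟨Module.finrank L W, by rw [← hbc, ← hWV, ← hmul, hLdeg]⟩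

/-! ### Algebra II: the rank of a `ℤ[G]`-module for `G` of prime order -/

/-- **Rank decomposition under a group of prime order.** Let a finite group `G` of prime order
`ℓ` act on a finitely generated abelian group `M` (`ρ : G →* End_ℤ M`), and let `A ≤ M` be the
subgroup of `G`-invariants. Then `rank_ℤ M = rank_ℤ A + (ℓ - 1) d` for some `d`: with the norm
`N = ∑_g ρ g` and `B = ker N`, `A ∩ B` is killed by `ℓ` (`N = ℓ` on `A`) and
`ℓ M ⊆ A + B` (`ℓ m = N m + (ℓ m - N m)`, `N² = ℓ N`), so `rank M = rank A + rank B`; and a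
generator `σ` of `G` acts on `B` with `1 + σ + ⋯ + σ^{ℓ-1} = N|_B = 0`, so `rank B` is a
multiple of `ℓ - 1` (`exists_finrank_eq_mul_of_sum_pow_eq_zero`). This is the integral form of
the decomposition `M ⊗ ℚ ≅ ℚ^a ⊕ ℚ(ζ_ℓ)^d` of a `ℚ[C_ℓ]`-module. [folklore] -/
theorem exists_finrank_eq_finrank_add_mul_of_prime_card {M : Type*} [AddCommGroup M]
    [Module.Finite ℤ M] {G : Type*} [Group G] [Fintype G] (ρ : G →* Module.End ℤ M) {ℓ : ℕ}
    (hℓ : ℓ.Prime) (hcard : Fintype.card G = ℓ) (A : Submodule ℤ M)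
    (hA : ∀ a ∈ A, ∀ g : G, ρ g a = a) (hA' : ∀ m : M, (∀ g : G, ρ g m = m) → m ∈ A) :
    ∃ d : ℕ, Module.finrank ℤ M = Module.finrank ℤ A + (ℓ - 1) * d := by
  -- the norm `N = ∑ g, ρ g` and its kernel `B`
  set N : Module.End ℤ M := ∑ g, ρ g with hN
  have hgN : ∀ g : G, ρ g * N = N := fun g => by
    rw [hN, Finset.mul_sum]
    simp_rw [← map_mul]
    exact Fintype.sum_equiv (Equiv.mulLeft g) _ _ fun h => rfl
  have hNg : ∀ g : G, N * ρ g = N := fun g => by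
    rw [hN, Finset.sum_mul]
    simp_rw [← map_mul]
    exact Fintype.sum_equiv (Equiv.mulRight g) _ _ fun h => rfl
  have hNA : ∀ m, N m ∈ A := fun m => hA' _ fun g => by
    rw [← Module.End.mul_apply, hgN]
  have hAN : ∀ a ∈ A, N a = (ℓ : ℤ) • a := fun a ha => by
    rw [hN, LinearMap.sum_apply, Finset.sum_congr rfl fun g _ => hA a ha g, Finset.sum_const,
      Finset.card_univ, hcard, natCast_zsmul]
  have hNN : N * N = (ℓ : ℤ) • N := by
    ext m
    rw [Module.End.mul_apply, hAN _ (hNA m), LinearMap.smul_apply]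
  set B : Submodule ℤ M := LinearMap.ker N with hB
  -- `A ⊓ B` is killed by `ℓ` and `ℓ M ⊆ A + B`, so `rank M = rank A + rank B`
  have hinf : ∀ x ∈ A ⊓ B, (ℓ : ℤ) • x = 0 := fun x hx => by
    rw [← hAN x hx.1]
    exact hx.2
  have hsup : ∀ m : M, (ℓ : ℤ) • m ∈ A ⊔ B := fun m => by
    have e : (ℓ : ℤ) • m = N m + ((ℓ : ℤ) • m - N m) := by abel
    rw [e]
    refine Submodule.add_mem_sup (hNA m) ?_
    rw [hB, LinearMap.mem_ker, map_sub, LinearMap.map_smul_of_tower, ← Module.End.mul_apply, hNN,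
      LinearMap.smul_apply, sub_self]
  have hrank := rank_eq_add_of_isCompl_up_to_torsion A B
    (Int.natCast_ne_zero.mpr hℓ.ne_zero) hinf hsup
  -- a generator `σ₀` of `G`: `∑_{j < ℓ} ρ (σ₀ ^ j) = N`
  obtain ⟨σ₀, hσ₀⟩ := Fintype.exists_ne_of_one_lt_card (by rw [hcard]; exact hℓ.one_lt) (1 : G)
  have hord : orderOf σ₀ = ℓ := by
    have h1 : orderOf σ₀ ∣ ℓ := hcard ▸ orderOf_dvd_card
    rcases (Nat.dvd_prime hℓ).mp h1 with h | h
    · exact absurd (orderOf_eq_one_iff.mp h) hσ₀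
    · exact h
  have hinj : Set.InjOn (fun j : ℕ => σ₀ ^ j) ↑(Finset.range ℓ) := by
    intro i hi j hj hij
    refine pow_injOn_Iio_orderOf (x := σ₀) ?_ ?_ hij
    · rw [Set.mem_Iio, hord]; exact Finset.mem_range.mp hi
    · rw [Set.mem_Iio, hord]; exact Finset.mem_range.mp hj
  have himage : (Finset.range ℓ).image (fun j : ℕ => σ₀ ^ j) = Finset.univ :=
    Finset.eq_univ_of_card _ (by rw [Finset.card_image_of_injOn hinj, Finset.card_range, hcard])
  have hsumpow : ∑ j ∈ Finset.range ℓ, ρ (σ₀ ^ j) = N := by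
    rw [hN, ← himage, Finset.sum_image hinj]
  -- `σ₀` restricts to `B`, where `1 + σ₀ + ⋯ + σ₀^{ℓ-1} = N|_B = 0`
  have hBinv : ∀ x ∈ B, ρ σ₀ x ∈ B := fun x hx => by
    rw [hB, LinearMap.mem_ker] at hx ⊢
    rw [← Module.End.mul_apply, hNg, hx]
  set T : Module.End ℤ B := (ρ σ₀).restrict hBinv with hTdef
  have hT : ∑ j ∈ Finset.range ℓ, T ^ j = 0 := by
    ext x
    rw [LinearMap.sum_apply, LinearMap.zero_apply, Submodule.coe_sum, Submodule.coe_zero]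
    have e : ∀ j, (((T ^ j) x : B) : M) = ρ (σ₀ ^ j) (x : M) := fun j => by
      rw [hTdef, Module.End.pow_restrict j hBinv, LinearMap.coe_restrict_apply, map_pow]
    simp_rw [e]
    rw [← LinearMap.sum_apply, hsumpow]
    exact x.2
  obtain ⟨d, hd⟩ := exists_finrank_eq_mul_of_sum_pow_eq_zero T hℓ hT
  refine ⟨d, ?_⟩
  rw [← hd]
  have key : ((Module.finrank ℤ M : ℕ) : Cardinal) =
      ((Module.finrank ℤ A + Module.finrank ℤ B : ℕ) : Cardinal) := by
    rw [Nat.cast_add, Module.finrank_eq_rank, Module.finrank_eq_rank, Module.finrank_eq_rank]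
    exact hrank
  exact_mod_cast key

end Literature.NumberTheory.EllipticCurves

/-! ### Elliptic curves: the rank in a cyclic extension of prime degree -/

namespace WeierstrassCurve

open Literature.NumberTheory.EllipticCurves WeierstrassCurve.Affine

/-- **The rank in a cyclic extension of prime degree.** Let `F/K` be a Galois extension of
number fields of prime degree `ℓ` (so `Gal(F/K) ≅ C_ℓ`) and `E/K` an elliptic curve (model
`W`). Then `rank_ℤ E(F) = rank_ℤ E(K) + (ℓ - 1) d` for some `d ≥ 0`; in particular
`rank E(F) ≡ rank E(K) (mod ℓ - 1)` and `rank E(K) ≤ rank E(F)`. Proof: `Gal(F/K)` acts on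
the finitely generated group `E(F)` (Mordell–Weil, tree theorem
`WeierstrassCurve.module_finite_point_holds`) by transport of coordinates, with invariants
`E(K)` (Galois descent: a point fixed by `Gal(F/K)` has coordinates in `K`), and
`exists_finrank_eq_finrank_add_mul_of_prime_card` applies: `E(F) ⊗ ℚ ≅ (E(K) ⊗ ℚ) ⊕ ℚ(ζ_ℓ)^d`
as `ℚ[C_ℓ]`-modules (`d` = the common multiplicity of the `ℓ - 1` faithful characters of
`C_ℓ`, which are conjugate over `ℚ`). [folklore] -/
theorem exists_mordellWeilRank_baseChange_eq_add_mul_of_prime {K : Type} [Field K]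
    [NumberField K] (W : WeierstrassCurve K) [W.IsElliptic] (F : Type) [Field F] [NumberField F]
    [Algebra K F] [IsGalois K F] {ℓ : ℕ} (hℓ : ℓ.Prime) (hF : Module.finrank K F = ℓ) :
    ∃ d : ℕ, (W.baseChange F).mordellWeilRank =
      (W.baseChange K).mordellWeilRank + (ℓ - 1) * d := by
  haveI : (W.baseChange F).IsElliptic := inferInstanceAs (W.map (algebraMap K F)).IsElliptic
  haveI : (W.baseChange K).IsElliptic := inferInstanceAs (W.map (algebraMap K K)).IsElliptic
  haveI : Module.Finite ℤ (W.baseChange F).toAffine.Point :=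
    (W.baseChange F).module_finite_point_holds
  haveI : Module.Finite ℤ (W.baseChange K).toAffine.Point :=
    (W.baseChange K).module_finite_point_holds
  haveI : FiniteDimensional K F := Module.finite_of_finrank_pos (by rw [hF]; exact hℓ.pos)
  have hcard : Fintype.card (F ≃ₐ[K] F) = ℓ := by
    rw [← Nat.card_eq_fintype_card, IsGalois.card_aut_eq_finrank, hF]
  -- `Gal(F/K)` acts on `E(F)` by transport of coordinates
  let ρ : (F ≃ₐ[K] F) →* Module.End ℤ (W.baseChange F).toAffine.Point :=
    { toFun := fun σ => (Point.map (W' := W.toAffine) (σ : F →ₐ[K] F)).toIntLinearMap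
      map_one' := by
        refine LinearMap.ext fun P => ?_
        rcases P with _ | ⟨x, y, h⟩ <;> rfl
      map_mul' := fun σ τ => by
        refine LinearMap.ext fun P => ?_
        rcases P with _ | ⟨x, y, h⟩ <;> rfl }
  -- the invariants are `E(K)`
  set ι : (W.baseChange K).toAffine.Point →ₗ[ℤ] (W.baseChange F).toAffine.Point :=
    (Point.baseChange (W' := W.toAffine) K F).toIntLinearMap with hι
  have hιinj : Function.Injective ι := Point.map_injective (W' := W.toAffine) (Algebra.ofId K F)
  set A : Submodule ℤ (W.baseChange F).toAffine.Point := LinearMap.range ι with hAdef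
  have hA : ∀ a ∈ A, ∀ σ : F ≃ₐ[K] F, ρ σ a = a := by
    rintro _ ⟨P, rfl⟩ σ
    exact Point.map_baseChange (W' := W.toAffine) (σ : F →ₐ[K] F) P
  have hA' : ∀ m : (W.baseChange F).toAffine.Point, (∀ σ : F ≃ₐ[K] F, ρ σ m = m) → m ∈ A := by
    intro m hm
    rcases m with _ | ⟨x, y, h⟩
    · exact ⟨0, rfl⟩
    · have hfix : ∀ z : F, (∀ σ : F ≃ₐ[K] F, σ z = z) → z ∈ Set.range (algebraMap K F) :=
        fun z hz => (IsGalois.mem_range_algebraMap_iff_fixed z).mpr hz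
      have hx : ∀ σ : F ≃ₐ[K] F, σ x = x := fun σ => by
        have e := hm σ
        change Point.map (W' := W.toAffine) (σ : F →ₐ[K] F) (Point.some x y h) = _ at e
        rw [Point.map_some] at e
        exact (Point.some.inj e).1
      have hy : ∀ σ : F ≃ₐ[K] F, σ y = y := fun σ => by
        have e := hm σ
        change Point.map (W' := W.toAffine) (σ : F →ₐ[K] F) (Point.some x y h) = _ at e
        rw [Point.map_some] at e
        exact (Point.some.inj e).2
      obtain ⟨x₀, rfl⟩ := hfix x hx
      obtain ⟨y₀, rfl⟩ := hfix y hy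
      have h₀ : (W.baseChange K).toAffine.Nonsingular x₀ y₀ :=
        (baseChange_nonsingular (W := W.toAffine) (f := Algebra.ofId K F)
          (Algebra.ofId K F).injective x₀ y₀).mp h
      exact ⟨Point.some x₀ y₀ h₀, rfl⟩
  obtain ⟨d, hd⟩ := exists_finrank_eq_finrank_add_mul_of_prime_card ρ hℓ hcard A hA hA'
  refine ⟨d, ?_⟩
  have hAK : Module.finrank ℤ A = Module.finrank ℤ (W.baseChange K).toAffine.Point :=
    (LinearEquiv.ofInjective ι hιinj).finrank_eq.symm
  unfold mordellWeilRank
  rw [hd, hAK]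

end WeierstrassCurve

end
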